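import Summits.ResolutionOfSingularities.ResolutionOfSingularities.Theorems.FrobeniusLadderFRationalResolutionFixedStratumQuotientIso
import HarnessLib

/-!
# Crux `FrobeniusLadder.FRationalResolution` (stmt-ResolutionOfSingularities-15317), line `redirect`,
# stub `stub_diagonalizableQuotientResolution` — **the centre of the round along a stratum: the chain ideal `(χ(s))`
# IS Kato's ideal `I(𝔓, χ)`, and it is PRIME at the fixed point with quotient the base stratum** (design C3 = the
# rank-2 stratum layer of the non-isolated case, memo MEMO-15317-leafhand2-g10 §2 (L1): the intrinsic centre
# `𝓘_{Sing}` of the round, read on a chart, is the chain ideal — radical because prime)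

Setting as in `…ChartAlgebraFixedPoint`: chart `φ : P → A`, chart algebra `C = A[χ(Q)]`, `L = ℤF_𝔭`, fixed prime `𝔓`
over `𝔭` (`χ(Q ∖ L) ⊆ 𝔓`), and a "chain" `s ⊆ Q ∖ L` generating `Q ∖ L` as a monoid ideal
(`…ConeChainCharts.round_charts`: `∀ q ∈ Q ∖ L, ∃ h ∈ s, q − h ∈ Q`).
* **`span_chain_eq_ideal`** — `(χ(h) : h ∈ s) = I(𝔓, χ)` as ideals of `C` (lineage 2's «centre of the round», there
  identified with the maximal ideal at a point of zero-dimensional stratum; along a positive-dimensional stratum it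
  is the ideal of the fixed STRATUM);
* **`isPrime_map_ideal_fixedPrime`** — `I(𝔓, χ)C_𝔓` is a prime ideal of `C_𝔓` (its quotient is `≅ A_𝔭/I(𝔭)A_𝔭`, a
  regular local ring, `…FixedStratumQuotientIso`); `isRadical_map_span_chain` — hence the chain ideal is radical at
  the fixed point: the blow-up centre of the round is the REDUCED fixed stratum, as the intrinsic recipe
  `X ↦ Bl_{𝓘_{Sing X}} X` requires.

Honest label: generic local algebra toward ONE leaf stub (no stub, crux or summit closed). No definitions, no named
facts, no sorry. [cite: Kato1994, Def. (2.1), (7.3), (10.1)] [cite: Niziol2006, §4]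
-/

noncomputable section

-- single-problem summit: the doubled namespace component is forced
set_option linter.dupNamespace false

open IsLocalRing Literature.AlgebraicGeometry.Resolution Literature.AlgebraicGeometry.Resolution.LogChart
open Summit.ResolutionOfSingularities.ResolutionOfSingularities.Theorems.FRationalResolution.ChartAlgebraNormalForm
open Summit.ResolutionOfSingularities.ResolutionOfSingularities.Theorems.FRationalResolution.ChartAlgebraFixedPoint
open Summit.ResolutionOfSingularities.ResolutionOfSingularities.Theorems.FRationalResolution.FixedStratumQuotientIso

namespace Summit.ResolutionOfSingularities.ResolutionOfSingularities.Theorems.FRationalResolution.FixedStratumCentre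

universe u

variable {A : Type u} [CommRing A] {n : ℕ} {P : AddSubmonoid (Fin n → ℤ)} {φ : Multiplicative P →* A}
  {𝔭 : Ideal A} [𝔭.IsPrime] {C : Type u} [CommRing C] [Algebra A C] {Q : AddSubmonoid (Fin n → ℤ)}
  {χ : Multiplicative Q →* C} {𝔓 : Ideal C} [𝔓.IsPrime] {s : Set (Fin n → ℤ)}

/-- **The chain ideal is Kato's ideal at the fixed prime: `(χ(h) : h ∈ s) = I(𝔓, χ)`.** Here `s ⊆ Q ∖ ℤF_𝔭` generates
`Q ∖ ℤF_𝔭` as a monoid ideal and `𝔓` is a prime over `𝔭` containing `χ(Q ∖ ℤF_𝔭)`. [cite: Kato1994, (10.1)] -/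
theorem span_chain_eq_ideal (hPQ : P ≤ Q)
    (hχ : ∀ p : P, χ (Multiplicative.ofAdd ⟨(p : Fin n → ℤ), hPQ p.2⟩) =
      algebraMap A C (φ (Multiplicative.ofAdd p)))
    (hsQ : s ⊆ Q) (hsL : ∀ h ∈ s, h ∉ Submodule.span ℤ (faceMonoid P φ 𝔭 : Set (Fin n → ℤ)))
    (hsgen : ∀ q ∈ Q, q ∉ Submodule.span ℤ (faceMonoid P φ 𝔭 : Set (Fin n → ℤ)) → ∃ h ∈ s, q - h ∈ Q)
    (h𝔓 : 𝔓.comap (algebraMap A C) = 𝔭)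
    (hq : ∀ q : Q, (q : Fin n → ℤ) ∉ Submodule.span ℤ (faceMonoid P φ 𝔭 : Set (Fin n → ℤ)) →
      χ (Multiplicative.ofAdd q) ∈ 𝔓) :
    Ideal.span ((fun q : Q => χ (Multiplicative.ofAdd q)) '' {q : Q | (q : Fin n → ℤ) ∈ s}) = ideal Q χ 𝔓 := by
  refine le_antisymm ?_ ?_
  · refine Ideal.span_le.2 ?_
    rintro _ ⟨q, hqs, rfl⟩
    exact Ideal.subset_span ⟨q, hq q (hsL _ hqs), rfl⟩
  · refine Ideal.span_le.2 ?_
    rintro _ ⟨q, hq𝔓, rfl⟩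
    have hqL : (q : Fin n → ℤ) ∉ Submodule.span ℤ (faceMonoid P φ 𝔭 : Set (Fin n → ℤ)) :=
      fun hL => (not_mem_iff_mem_span_of_comap_eq hPQ hχ h𝔓 hq q).2 hL hq𝔓
    obtain ⟨h, hhs, hqh⟩ := hsgen q q.2 hqL
    have e : χ (Multiplicative.ofAdd q) =
        χ (Multiplicative.ofAdd ⟨h, hsQ hhs⟩) * χ (Multiplicative.ofAdd ⟨(q : Fin n → ℤ) - h, hqh⟩) := by
      rw [← map_mul, ← ofAdd_add]
      congr 1
      apply Multiplicative.toAdd.injective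
      apply Subtype.ext
      change (q : Fin n → ℤ) = h + ((q : Fin n → ℤ) - h)
      abel
    show χ (Multiplicative.ofAdd q) ∈ Ideal.span _
    rw [e]
    exact Ideal.mul_mem_right _ _ (Ideal.subset_span ⟨⟨h, hsQ hhs⟩, hhs, rfl⟩)

/-- **`I(𝔓, χ)C_𝔓` is prime** at a torus-fixed stratum point (its quotient is `≅ A_𝔭/I(𝔭)A_𝔭`, a regular local ring,
hence a domain). Hypotheses as in `…FixedStratumQuotientIso.nonempty_ringEquiv_quotient_fixedPrime`.
[cite: Kato1994, Def. (2.1), (7.3), (10.1)] -/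
theorem isPrime_map_ideal_fixedPrime [IsNoetherianRing A] (hP : P.FG)
    (hsat : ∀ (v : Fin n → ℤ) (k : ℕ), 0 < k → k • v ∈ P → v ∈ P) (hreg : IsLogRegularAt P φ 𝔭)
    (hreg' : ∀ (𝔮 : Ideal A) [𝔮.IsPrime], 𝔮 ≤ 𝔭 → ideal P φ 𝔭 ≤ 𝔮 → IsLogRegularAt P φ 𝔮)
    (hPQ : P ≤ Q)
    (hχ : ∀ p : P, χ (Multiplicative.ofAdd ⟨(p : Fin n → ℤ), hPQ p.2⟩) =
      algebraMap A C (φ (Multiplicative.ofAdd p)))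
    (hgen : Algebra.adjoin A (Set.range χ) = ⊤)
    (hD : ∀ q ∈ Q, ∃ p ∈ P, q + p ∈ P)
    (hK : ∀ a : A, algebraMap A C a = 0 → ∃ p : P, φ (Multiplicative.ofAdd p) * a = 0)
    (hS : ∀ q₁ ∈ Q, ∀ q₂ ∈ Q, q₁ + q₂ ∈ Submodule.span ℤ (faceMonoid P φ 𝔭 : Set (Fin n → ℤ)) →
      q₁ ∈ Submodule.span ℤ (faceMonoid P φ 𝔭 : Set (Fin n → ℤ)))
    (hH : ∀ q ∈ Q, ∀ p ∈ P, q + p ∈ Submodule.span ℤ (faceMonoid P φ 𝔭 : Set (Fin n → ℤ)) →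
      q ∈ Submodule.span ℤ (faceMonoid P φ 𝔭 : Set (Fin n → ℤ)))
    (h𝔓 : 𝔓.comap (algebraMap A C) = 𝔭)
    (hq : ∀ q : Q, (q : Fin n → ℤ) ∉ Submodule.span ℤ (faceMonoid P φ 𝔭 : Set (Fin n → ℤ)) →
      χ (Multiplicative.ofAdd q) ∈ 𝔓) :
    ((ideal Q χ 𝔓).map (algebraMap C (Localization.AtPrime 𝔓))).IsPrime := by
  obtain ⟨e⟩ := nonempty_ringEquiv_quotient_fixedPrime hP hsat hreg hreg' hPQ hχ hgen hD hK hS hH h𝔓 hq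
  haveI : IsRegularLocalRing (Localization.AtPrime 𝔭 ⧸
      (ideal P φ 𝔭).map (algebraMap A (Localization.AtPrime 𝔭))) := hreg.1
  haveI : IsDomain (Localization.AtPrime 𝔭 ⧸
      (ideal P φ 𝔭).map (algebraMap A (Localization.AtPrime 𝔭))) := isDomain_of_isRegularLocalRing _
  haveI : IsDomain (Localization.AtPrime 𝔓 ⧸ (ideal Q χ 𝔓).map (algebraMap C (Localization.AtPrime 𝔓))) :=
    MulEquiv.isDomain _ e.symm.toMulEquiv
  exact (Ideal.Quotient.isDomain_iff_prime _).mp inferInstance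

/-- **The chain ideal is radical at the fixed point**: `(χ(s))C_𝔓` is a prime, hence radical, ideal of `C_𝔓` — the
centre of the round is the REDUCED fixed stratum. [cite: Kato1994, (7.3), (10.1)] -/
theorem isRadical_map_span_chain [IsNoetherianRing A] (hP : P.FG)
    (hsat : ∀ (v : Fin n → ℤ) (k : ℕ), 0 < k → k • v ∈ P → v ∈ P) (hreg : IsLogRegularAt P φ 𝔭)
    (hreg' : ∀ (𝔮 : Ideal A) [𝔮.IsPrime], 𝔮 ≤ 𝔭 → ideal P φ 𝔭 ≤ 𝔮 → IsLogRegularAt P φ 𝔮)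
    (hPQ : P ≤ Q)
    (hχ : ∀ p : P, χ (Multiplicative.ofAdd ⟨(p : Fin n → ℤ), hPQ p.2⟩) =
      algebraMap A C (φ (Multiplicative.ofAdd p)))
    (hgen : Algebra.adjoin A (Set.range χ) = ⊤)
    (hD : ∀ q ∈ Q, ∃ p ∈ P, q + p ∈ P)
    (hK : ∀ a : A, algebraMap A C a = 0 → ∃ p : P, φ (Multiplicative.ofAdd p) * a = 0)
    (hS : ∀ q₁ ∈ Q, ∀ q₂ ∈ Q, q₁ + q₂ ∈ Submodule.span ℤ (faceMonoid P φ 𝔭 : Set (Fin n → ℤ)) →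
      q₁ ∈ Submodule.span ℤ (faceMonoid P φ 𝔭 : Set (Fin n → ℤ)))
    (hH : ∀ q ∈ Q, ∀ p ∈ P, q + p ∈ Submodule.span ℤ (faceMonoid P φ 𝔭 : Set (Fin n → ℤ)) →
      q ∈ Submodule.span ℤ (faceMonoid P φ 𝔭 : Set (Fin n → ℤ)))
    (hsQ : s ⊆ Q) (hsL : ∀ h ∈ s, h ∉ Submodule.span ℤ (faceMonoid P φ 𝔭 : Set (Fin n → ℤ)))
    (hsgen : ∀ q ∈ Q, q ∉ Submodule.span ℤ (faceMonoid P φ 𝔭 : Set (Fin n → ℤ)) → ∃ h ∈ s, q - h ∈ Q)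
    (h𝔓 : 𝔓.comap (algebraMap A C) = 𝔭)
    (hq : ∀ q : Q, (q : Fin n → ℤ) ∉ Submodule.span ℤ (faceMonoid P φ 𝔭 : Set (Fin n → ℤ)) →
      χ (Multiplicative.ofAdd q) ∈ 𝔓) :
    ((Ideal.span ((fun q : Q => χ (Multiplicative.ofAdd q)) '' {q : Q | (q : Fin n → ℤ) ∈ s})).map
        (algebraMap C (Localization.AtPrime 𝔓))).IsPrime ∧
      ((Ideal.span ((fun q : Q => χ (Multiplicative.ofAdd q)) '' {q : Q | (q : Fin n → ℤ) ∈ s})).map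
        (algebraMap C (Localization.AtPrime 𝔓))).IsRadical := by
  rw [span_chain_eq_ideal hPQ hχ hsQ hsL hsgen h𝔓 hq]
  have hp := isPrime_map_ideal_fixedPrime hP hsat hreg hreg' hPQ hχ hgen hD hK hS hH h𝔓 hq
  exact ⟨hp, hp.isRadical⟩

end Summit.ResolutionOfSingularities.ResolutionOfSingularities.Theorems.FRationalResolution.FixedStratumCentre

end
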